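import Literature.Barriers.CriticalPhenomena.PlaquetteWalkHoleRootSevenTopRow
import Literature.Barriers.CriticalPhenomena.PlaquetteWalkHoleRootRayArc
import Literature.Barriers.CriticalPhenomena.PlaquetteWalkStraightRuns
import HarnessLib

/-!
# Barrier catalogue (SAWScalingLimit): the frame of the cost-`7` vertical-end parents above the root row, I — `r` IS ENTERED FROM BELOW («COLUMN LAW», F1)

`Z → ∞` limit model of the printed Yang–Baxter weights [GlazmanManolescu2019, §1, eq. (1)]; the «RECTANGLE COEFFICIENT» line of the venture lane «pcv-sawmu»
(b-engine-1 g26), step F1 of the FRAME of the cost-`7` vertical-end parents of the class-`B2b` members above the root row (DESIGN-next-g26 §4). By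
`ΩG.top_row_of_cost_seven_vert_above` such a parent has `r` in its top row and its first arc in `r` uses `S` and the horizontal side opposite to the end side;
★★★ `ΩG.sIn_firstHit_eq_S_of_cost_seven_E_above`: when the end side is `E`, that arc is `S → W` — `r` is entered FROM BELOW. If it were `W → S`, the west
chain of `r` along the top row ends at an isolated turn `t` entered from below BEFORE the first hit, the parity arc of the excursion on the western ray
(`ΩG.exists_arc_west_rootRow_after_fh`) lies in a straight vertical plaquette whose column climbs to `t`, and reading the column backwards from `t` dates that
arc before the first hit — a contradiction. Chain calculus (`PlaquetteWalkKissChains`), straight runs (`PlaquetteWalkStraightRuns`, `PlaquetteWalkHoleRootRayArc`),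
six isolated turns. [GlazmanManolescu2019 §1 Fig. 1, eq. (1), Lemma 2.1, Remark 2.2; Glazman2015WeightedSAW Lemma 3.1 (proof, pp. 6–7); CourantRobbins1958 Ch. V App. §2]
-/

noncomputable section

namespace Literature.Probability.RandomPlanarGeometry.SAW.YangBaxter

open Real
open Literature.Barriers.CriticalPhenomena.PlaquetteWalk

open private fc_fh fh_add_Mv three_le_Mv from Literature.Probability.RandomPlanarGeometry.YangBaxterSAWGeneralDomain

namespace ΩG

variable {D : Set Face} {w r : Face} {ω : ΩG D (w.side .W) r}

/-- ★★★ **`r` IS ENTERED FROM BELOW** (end side `E`): for a wound class-`B2a` walk of limit cost `7` from the hole root `w.side W` at a rhombus `r` strictly above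
the root row and in the root column or east of it, ending on the `E` side of `r` with a turning first arc in `r`, that first arc enters `r` through `S` and
leaves through `W`. [cite: GlazmanManolescu2019, §1, Fig. 1 and eq. (1); Lemma 2.1; Remark 2.2] [cite: Glazman2015WeightedSAW, Lemma 3.1 (proof, pp. 6–7)]
[cite: CourantRobbins1958, Ch. V Appendix §2 (the even–odd rule)] -/
theorem sIn_firstHit_eq_S_of_cost_seven_E_above (hh : holeFaceW w ∉ D) (hr : RootedFace D (w.side .W) r) (h : ω.IsB2a)
    (hA : ω.AJ hr h (toC (midPt (w.side .W))) ≠ 0) (hc : cost (slotOfSide ω.1) ω.2.mids = 7) (hE : ω.1 = .E)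
    (hNS : arcKind (ω.2.sIn ω.2.firstHitG) (ω.2.sOut ω.2.firstHitG) ≠ .straight) (habove : w.2 < r.2) (hcol : w.1 ≤ r.1) :
    ω.2.sIn ω.2.firstHitG = .S ∧ ω.2.sOut ω.2.firstHitG = .W := by
  classical
  set n := ω.2.arcs.length with hn
  have hz : ω.1 = .E ∨ ω.1 = .W := Or.inl hE
  ---------------------------------------------------------------- counts: six isolated turns
  have hd : slotDeg (slotOfSide ω.1) = 0 := by rw [hE]; rfl
  have h6 : cfgCount ω.2.mids [.corner] + cfgCount ω.2.mids [.coCorner] = 6 := by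
    have hcost : cost (slotOfSide ω.1) ω.2.mids =
        cfgCount ω.2.mids [.corner] + cfgCount ω.2.mids [.coCorner] + (1 - slotDeg (slotOfSide ω.1)) := rfl
    rw [hcost, hd] at hc; omega
  let P : Face → Prop := fun f => f ∈ facesL ω.2.mids ∧ (kindsL ω.2.mids f = [.corner] ∨ kindsL ω.2.mids f = [.coCorner])
  have hPiso : ∀ k < n, (∀ l < n, ω.2.fc l = ω.2.fc k → l = k) → arcKind (ω.2.sIn k) (ω.2.sOut k) ≠ .straight → P (ω.2.fc k) :=
    fun k hk hsv hkind => isolated_turn hk hsv hkind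
  have hle6 : ∀ T : Finset Face, (∀ f ∈ T, P f) → T.card ≤ 6 := by
    intro T hT; have := YBWalk.card_le_cfgCount_add ω.2.mids T hT; omega
  have hPD : ∀ f s, ω.2.UsesSide f s → f ∈ D := by
    rintro f s ⟨i, hi, hfi, -⟩; rw [← hfi]; exact (YBWalk.arcFace_arcAt hi).2
  ---------------------------------------------------------------- basics
  have hF := ω.fh_lt h
  have hlen : 0 < n := by omega
  have h0w : ω.2.fc 0 = w := fc_zero_eq_root w hh ω.2 hlen
  have h0W : ω.2.sIn 0 = .W := YBWalk.sIn_zero_eq_W hh ω.2 hlen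
  have h0E : ω.2.sIn 0 ≠ .E := by rw [h0W]; decide
  have h0S : ω.2.sIn 0 ≠ .S := by rw [h0W]; decide
  have h0N : ω.2.sIn 0 ≠ .N := by rw [h0W]; decide
  obtain ⟨hzW, hfcZ⟩ : ω.2.sOut (n - 1) = .W ∧ ω.2.fc (n - 1) = (r.1 + 1, r.2) := by
    rcases last_of_vertical_end hr h hz with ⟨-, h1, h2⟩ | ⟨hW, -, -⟩
    · exact ⟨h1, h2⟩
    · rw [hE] at hW; exact absurd hW (by decide)
  have hzE' : ω.2.sOut (n - 1) ≠ .E := by rw [hzW]; decide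
  have hzS' : ω.2.sOut (n - 1) ≠ .S := by rw [hzW]; decide
  have hzN' : ω.2.sOut (n - 1) ≠ .N := by rw [hzW]; decide
  have hfne3 : ω.2.firstHitG + 3 ≤ n := by have := three_le_Mv hr h; have := fh_add_Mv h; unfold ΩG.Mv at *; omega
  have hfcF := (fc_fh ω hr h).1
  have hsvr : ∀ l < n, ω.2.fc l = ω.2.fc ω.2.firstHitG → l = ω.2.firstHitG := fun l hl e => eq_firstHitG_of_fc_eq hr h hl e
  have hPr : P r := by rw [← hfcF]; exact hPiso _ hF hsvr hNS
  have hrside : ∀ s, ω.2.UsesSide r s → r.side s ≠ r.side ω.1 := by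
    rintro s ⟨l, hl, hfl, hs⟩ e
    have hl' := hsvr l hl (hfl.trans hfcF.symm)
    obtain ⟨hin, hout⟩ := ω.2.side_sIn_eq_nth hl
    rw [hfl] at hin hout
    rw [← ω.2.nth_length] at e
    rcases hs with hs | hs
    · rw [hs] at hin; have := ω.2.nth_inj (show l ≤ n by omega) le_rfl (hin.symm.trans e).symm.symm; omega
    · rw [hs] at hout; have := ω.2.nth_inj (show l + 1 ≤ n by omega) le_rfl (hout.symm.trans e).symm.symm; omega
  have hneF := ω.2.sIn_ne_sOut hF
  obtain ⟨X, hXw, hX, -⟩ := exists_left_entry_turn hh hr h hA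
  obtain ⟨X', -, hX', -⟩ := exists_right_entry_turn hh hr h
  ---------------------------------------------------------------- the top row is `r.2`; the first arc uses `S` and `W`
  have htop := top_row_of_cost_seven_vert_above hh hr h hA hc hz hNS habove
  obtain ⟨hSr, hnN1, hnN2⟩ := usesSide_S_of_cost_seven_vert_above hh hr h hA hc hz hNS habove
  have hnE1 : ω.2.sIn ω.2.firstHitG ≠ .E := fun e => hrside .E ⟨_, hF, hfcF, Or.inl e⟩ (by rw [hE])
  have hnE2 : ω.2.sOut ω.2.firstHitG ≠ .E := fun e => hrside .E ⟨_, hF, hfcF, Or.inr e⟩ (by rw [hE])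
  -- so the arc is `S → W` or `W → S`; suppose the latter
  have key : (ω.2.sIn ω.2.firstHitG = .S ∧ ω.2.sOut ω.2.firstHitG = .W) ∨ (ω.2.sIn ω.2.firstHitG = .W ∧ ω.2.sOut ω.2.firstHitG = .S) := by
    revert hSr hnN1 hnN2 hnE1 hnE2 hneF
    cases ω.2.sIn ω.2.firstHitG <;> cases ω.2.sOut ω.2.firstHitG <;> decide
  rcases key with hgood | ⟨hWin, hSout⟩
  · exact hgood
  exfalso
  have hNtop := forall_top_ne_N hh hr h htop habove
  have hupN : ∀ f : Face, f.2 = r.2 → ¬ω.2.UsesSide f .N := by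
    rintro f hf ⟨i, hi, hfi, hs | hs⟩
    · exact (hNtop i hi (by rw [hfi, hf])).1 hs
    · exact (hNtop i hi (by rw [hfi, hf])).2 hs
  ---------------------------------------------------------------- the bottom turns and the root-row turn `τ`
  obtain ⟨Y', hY'w, hY', j₀, j₁, -, hj₀2, hrow₀', hN₀', hWE₀', -, hj₁, hrow₁', -, halt'⟩ := bottom_exit_or_end hh hr h hA
  obtain ⟨hN₁', hWE₁', -, hfne'⟩ : (ω.2.sOut j₁ = .N ∧ (ω.2.sIn j₁ = .W ∨ ω.2.sIn j₁ = .E) ∧ j₀ ≠ j₁ ∧ ω.2.fc j₀ ≠ ω.2.fc j₁) := by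
    rcases halt' with hh' | ⟨-, -, hrY'⟩
    · exact hh'
    · exfalso; omega
  have hj₀ : j₀ < n := by omega
  have hsvB : ∀ k, k < n → (ω.2.fc k).2 = Y' → ∀ l < n, ω.2.fc l = ω.2.fc k → l = k :=
    fun k hk hrw l hl e => (bottom_single_visit hh hr h hY' (by omega) hk hl hrw e.symm).symm
  have hPb₀ : P (ω.2.fc j₀) := hPiso j₀ hj₀ (hsvB j₀ hj₀ hrow₀') (by rw [hN₀']; exact YBWalk.arcKind_ne_straight_of_S_WE (Or.inr rfl) hWE₀')
  have hPb₁ : P (ω.2.fc j₁) := hPiso j₁ hj₁ (hsvB j₁ hj₁ hrow₁') (by rw [hN₁']; exact YBWalk.arcKind_ne_straight_of_WE_S hWE₁' (Or.inr rfl))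
  have hk₁ex : ∃ k, arcKind (ω.2.sIn k) (ω.2.sOut k) ≠ .straight := ⟨_, hNS⟩
  set k₁ := Nat.find hk₁ex with hk₁def
  have hturn : arcKind (ω.2.sIn k₁) (ω.2.sOut k₁) ≠ .straight := Nat.find_spec hk₁ex
  have hk₁F : k₁ ≤ ω.2.firstHitG := Nat.find_min' hk₁ex hNS
  have hk₁ : k₁ < n := by omega
  have hstr : ∀ i < k₁, arcKind (ω.2.sIn i) (ω.2.sOut i) = .straight := by
    intro i hi; by_contra hne; exact Nat.find_min hk₁ex hi hne
  obtain ⟨hrun, -⟩ := ω.2.initial_run hh hk₁ hstr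
  obtain ⟨hfk, hWk⟩ := hrun k₁ le_rfl
  have hp₁W : ω.2.UsesSide (w.1 + k₁, w.2) .W := ⟨k₁, hk₁, hfk, Or.inl hWk⟩
  obtain ⟨τ1, hPτ, hτ1⟩ : ∃ τ1 : ℤ, P (τ1, w.2) ∧ w.1 ≤ τ1 := by
    by_cases hpE : ω.2.UsesSide (w.1 + k₁, w.2) .E
    · obtain ⟨M, hWall, -, hend⟩ := ω.2.chain_E hX' hpE
      rcases hend with ⟨hM1, hnot⟩ | ⟨-, hs0⟩ | ⟨hZ, -⟩
      · obtain ⟨i', hi', hfc', hsv', -, -, -, hk'⟩ := ω.2.isolated_of_usesSide_not_opp (hWall M hM1 le_rfl) hnot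
        refine ⟨w.1 + k₁ + M, ?_, by omega⟩
        have := hPiso i' hi' hsv' hk'; rw [hfc'] at this; exact this
      · exact absurd hs0 h0E
      · rw [hfcZ] at hZ; have := congrArg Prod.snd hZ; simp only at this; omega
    · obtain ⟨i', hi', hfc', hsv', -, -, -, hk'⟩ := ω.2.isolated_of_usesSide_not_opp hp₁W hpE
      refine ⟨w.1 + k₁, ?_, by omega⟩
      have := hPiso i' hi' hsv' hk'; rw [hfc'] at this; exact this
  ---------------------------------------------------------------- the west turn `t = (r.1 − M, r.2)`, entered from below at index `firstHitG − M`
  obtain ⟨M, hEall, hWall, hend⟩ := ω.2.chain_W hX ⟨_, hF, hfcF, Or.inl hWin⟩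
  obtain ⟨hM1, hnotW⟩ : 1 ≤ M ∧ ¬ω.2.UsesSide (r.1 - M, r.2) .W := by
    rcases hend with hT | ⟨hA0, -⟩ | ⟨hZ, -⟩
    · exact hT
    · rw [h0w] at hA0; have := congrArg Prod.snd hA0; simp only at this; omega
    · rw [hfcZ] at hZ; have := congrArg Prod.fst hZ; simp only at this; omega
  obtain ⟨iT, hiT, hfcT, hsvT, hET, hninT, hnoutT, hkT⟩ := ω.2.isolated_of_usesSide_not_opp (hEall M hM1 le_rfl) hnotW
  have hPt : P (r.1 - M, r.2) := by rw [← hfcT]; exact hPiso iT hiT hsvT hkT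
  -- reading the straight cells between `t` and `r` backwards from `r`
  have hcellsW : ∀ m : ℕ, 1 ≤ m → m ≤ M - 1 → ∀ i < n,
      ω.2.fc i = ((ω.2.fc ω.2.firstHitG).1 - m, (ω.2.fc ω.2.firstHitG).2) → arcKind (ω.2.sIn i) (ω.2.sOut i) = .straight := by
    intro m hm1 hmM i hi hfi
    rw [hfcF] at hfi
    exact ω.2.straight_of_usesSide_EW (hEall m hm1 (by omega)) (hWall m (by omega)) (hupN _ rfl) i hi hfi
  have hMF : M ≤ ω.2.firstHitG := by
    by_contra hlt
    push Not at hlt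
    obtain ⟨hfc0, -⟩ := ω.2.run_back_west_of_straight hF (show ω.2.firstHitG ≤ ω.2.firstHitG from le_rfl) hWin
      (fun m hm1 hmM i hi hfi => hcellsW m hm1 (by omega) i hi hfi) ω.2.firstHitG le_rfl
    rw [Nat.sub_self, h0w, hfcF] at hfc0
    have := congrArg Prod.snd hfc0; simp only at this; omega
  have hrunW := ω.2.run_back_west_of_straight hF (show M - 1 ≤ ω.2.firstHitG by omega) hWin hcellsW
  obtain ⟨hfcM1, hinM1⟩ := hrunW (M - 1) le_rfl
  rw [hfcF] at hfcM1
  have hM1F : 1 ≤ ω.2.firstHitG - (M - 1) := by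
    by_contra hlt
    have e0 : ω.2.firstHitG - (M - 1) = 0 := by omega
    rw [e0, h0w] at hfcM1
    have := congrArg Prod.snd hfcM1; simp only at this; omega
  obtain ⟨hfcT', houtT'⟩ := ω.2.fc_pred_eq_of_sIn_W (show ω.2.firstHitG - (M - 1) < n by omega) hM1F hinM1
  rw [hfcM1] at hfcT'
  rw [show ω.2.firstHitG - (M - 1) - 1 = ω.2.firstHitG - M by omega] at hfcT' houtT'
  have hfcT'' : ω.2.fc (ω.2.firstHitG - M) = (r.1 - M, r.2) := by
    rw [hfcT']; exact Prod.ext (by simp only; omega) rfl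
  have hiTF : ω.2.firstHitG - M = iT := hsvT _ (by omega) (hfcT''.trans hfcT.symm)
  have hinT : ω.2.sIn iT = .S := by
    rw [← hiTF]
    have hne := ω.2.sIn_ne_sOut (show ω.2.firstHitG - M < n by omega)
    rw [houtT'] at hne
    have h1 := (hNtop _ (show ω.2.firstHitG - M < n by omega) (by rw [hfcT''])).1
    have h2 : ω.2.sIn (ω.2.firstHitG - M) ≠ .W := by rw [hiTF]; exact hninT
    revert hne h1 h2; cases ω.2.sIn (ω.2.firstHitG - M) <;> decide
  have hiTlt : iT < ω.2.firstHitG := by omega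
  ---------------------------------------------------------------- at most ONE isolated turn besides `t, r, b₀, b₁, τ`
  have hne_of_row : ∀ f g : Face, f.2 ≠ g.2 → f ≠ g := fun f g hfg e => hfg (by rw [e])
  have houts : ∀ g₁ g₂ : Face, P g₁ → P g₂ → g₁ ≠ g₂ →
      g₁ ≠ ((r.1 : ℤ) - M, r.2) → g₁ ≠ r → g₁ ≠ ω.2.fc j₀ → g₁ ≠ ω.2.fc j₁ → g₁ ≠ ((τ1 : ℤ), w.2) →
      g₂ ≠ ((r.1 : ℤ) - M, r.2) → g₂ ≠ r → g₂ ≠ ω.2.fc j₀ → g₂ ≠ ω.2.fc j₁ → g₂ ≠ ((τ1 : ℤ), w.2) → False := by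
    intro g₁ g₂ hg₁ hg₂ hne a1 a2 a3 a4 a5 c1 c2 c3 c4 c5
    have hT : ∀ x ∈ ({((r.1 : ℤ) - M, r.2), r, ω.2.fc j₀, ω.2.fc j₁, ((τ1 : ℤ), w.2), g₁, g₂} : Finset Face), P x := by
      intro x hx
      simp only [Finset.mem_insert, Finset.mem_singleton] at hx
      rcases hx with rfl | rfl | rfl | rfl | rfl | rfl | rfl
      exacts [hPt, hPr, hPb₀, hPb₁, hPτ, hg₁, hg₂]
    have n01 : (((r.1 : ℤ) - M, r.2) : Face) ≠ r := by intro e; have := congrArg Prod.fst e; simp only at this; omega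
    have n02 := hne_of_row ((r.1 : ℤ) - M, r.2) (ω.2.fc j₀) (by rw [hrow₀']; simp only; omega)
    have n03 := hne_of_row ((r.1 : ℤ) - M, r.2) (ω.2.fc j₁) (by rw [hrow₁']; simp only; omega)
    have n04 := hne_of_row ((r.1 : ℤ) - M, r.2) ((τ1 : ℤ), w.2) (by simp only; omega)
    have n12 := hne_of_row r (ω.2.fc j₀) (by rw [hrow₀']; omega)
    have n13 := hne_of_row r (ω.2.fc j₁) (by rw [hrow₁']; omega)
    have n14 := hne_of_row r ((τ1 : ℤ), w.2) (by simp only; omega)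
    have n23 := hfne'
    have n24 := hne_of_row (ω.2.fc j₀) ((τ1 : ℤ), w.2) (by rw [hrow₀']; simp only; omega)
    have n34 := hne_of_row (ω.2.fc j₁) ((τ1 : ℤ), w.2) (by rw [hrow₁']; simp only; omega)
    have hcard : ({((r.1 : ℤ) - M, r.2), r, ω.2.fc j₀, ω.2.fc j₁, ((τ1 : ℤ), w.2), g₁, g₂} : Finset Face).card = 7 := by
      rw [Finset.card_insert_of_notMem (by simp only [Finset.mem_insert, Finset.mem_singleton, not_or]; exact ⟨n01, n02, n03, n04, a1.symm, c1.symm⟩),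
        Finset.card_insert_of_notMem (by simp only [Finset.mem_insert, Finset.mem_singleton, not_or]; exact ⟨n12, n13, n14, a2.symm, c2.symm⟩),
        Finset.card_insert_of_notMem (by simp only [Finset.mem_insert, Finset.mem_singleton, not_or]; exact ⟨n23, n24, a3.symm, c3.symm⟩),
        Finset.card_insert_of_notMem (by simp only [Finset.mem_insert, Finset.mem_singleton, not_or]; exact ⟨n34, a4.symm, c4.symm⟩),
        Finset.card_insert_of_notMem (by simp only [Finset.mem_insert, Finset.mem_singleton, not_or]; exact ⟨a5.symm, c5.symm⟩),
        Finset.card_insert_of_notMem (by simp only [Finset.mem_singleton]; exact hne), Finset.card_singleton]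
    have := hle6 _ hT
    omega
  -- an isolated turn of the root row west of the hole, or of a middle row, is an "outsider"
  have hout_row : ∀ g : Face, g.2 = w.2 → g.1 < w.1 →
      g ≠ ((r.1 : ℤ) - M, r.2) ∧ g ≠ r ∧ g ≠ ω.2.fc j₀ ∧ g ≠ ω.2.fc j₁ ∧ g ≠ ((τ1 : ℤ), w.2) := by
    intro g hg2 hg1
    refine ⟨hne_of_row _ _ (by rw [hg2]; simp only; omega), hne_of_row _ _ (by rw [hg2]; omega),
      hne_of_row _ _ (by rw [hg2, hrow₀']; omega), hne_of_row _ _ (by rw [hg2, hrow₁']; omega), ?_⟩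
    intro e; have := congrArg Prod.fst e; simp only at this; omega
  have hout_mid : ∀ g : Face, w.2 < g.2 → g.2 < r.2 →
      g ≠ ((r.1 : ℤ) - M, r.2) ∧ g ≠ r ∧ g ≠ ω.2.fc j₀ ∧ g ≠ ω.2.fc j₁ ∧ g ≠ ((τ1 : ℤ), w.2) := by
    intro g h1 h2
    exact ⟨hne_of_row _ _ (by simp only; omega), hne_of_row _ _ (by omega), hne_of_row _ _ (by rw [hrow₀']; omega),
      hne_of_row _ _ (by rw [hrow₁']; omega), hne_of_row _ _ (by simp only; omega)⟩
  ---------------------------------------------------------------- the parity arc `i' ≥ firstHitG` at `P₀ = (x₀, w.2)`, `x₀ ≤ w.1 − 2`, through `S`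
  obtain ⟨i', hi'F, hi'n, hrowP, hcolP, hSP⟩ := exists_arc_west_rootRow_after_fh hh hr h hA hcol
  set x₀ := (ω.2.fc i').1 with hx₀
  have hfcP : ω.2.fc i' = (x₀, w.2) := Prod.ext rfl hrowP
  -- the horizontal chains of a root-row plaquette west of the hole end at outsiders
  have hWend : ∀ x : ℤ, x ≤ w.1 - 2 → ω.2.UsesSide (x, w.2) .W → ∃ g : Face, P g ∧ g.2 = w.2 ∧ g.1 < x := by
    intro x hx hW
    obtain ⟨M₁, hE₁, -, hend₁⟩ := ω.2.chain_W hX hW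
    rcases hend₁ with ⟨hM1', hnot⟩ | ⟨hA0, -⟩ | ⟨hZ, -⟩
    · obtain ⟨i₁, hi₁, hfc₁, hsv₁, -, -, -, hk₁'⟩ := ω.2.isolated_of_usesSide_not_opp (hE₁ M₁ hM1' le_rfl) hnot
      refine ⟨((x : ℤ) - M₁, w.2), ?_, rfl, by simp only; omega⟩
      show P ((((x : ℤ), w.2) : Face).1 - (M₁ : ℤ), (((x : ℤ), w.2) : Face).2)
      rw [← hfc₁]; exact hPiso i₁ hi₁ hsv₁ hk₁'
    · rw [h0w] at hA0; have := congrArg Prod.fst hA0; simp only at this; omega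
    · rw [hfcZ] at hZ; have := congrArg Prod.snd hZ; simp only at this; omega
  have hEend : ∀ x : ℤ, x ≤ w.1 - 2 → ω.2.UsesSide (x, w.2) .E → ∃ g : Face, P g ∧ g.2 = w.2 ∧ x < g.1 ∧ g.1 ≤ w.1 - 2 := by
    intro x hx hEx
    obtain ⟨M₂, hW₂, -, hend₂⟩ := ω.2.chain_E hX' hEx
    -- the chain stays west of the hole
    have hhole : ∀ m : ℕ, 1 ≤ m → m ≤ M₂ → x + m ≠ w.1 - 1 := by
      intro m hm1 hm2 e
      have hD := hPD _ _ (hW₂ m hm1 hm2)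
      simp only at hD
      rw [e] at hD
      exact hh (by simpa [holeFaceW] using hD)
    have hM₂w : x + M₂ ≤ w.1 - 2 := by
      by_contra hlt
      exact hhole (w.1 - 1 - x).toNat (by omega) (by omega) (by omega)
    rcases hend₂ with ⟨hM1', hnot⟩ | ⟨hA0, -⟩ | ⟨-, hsZ⟩
    · obtain ⟨i₁, hi₁, hfc₁, hsv₁, -, -, -, hk₁'⟩ := ω.2.isolated_of_usesSide_not_opp (hW₂ M₂ hM1' le_rfl) hnot
      refine ⟨((x : ℤ) + M₂, w.2), ?_, rfl, by simp only; omega, by simp only; omega⟩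
      show P ((((x : ℤ), w.2) : Face).1 + (M₂ : ℤ), (((x : ℤ), w.2) : Face).2)
      rw [← hfc₁]; exact hPiso i₁ hi₁ hsv₁ hk₁'
    · rw [h0w] at hA0; have := congrArg Prod.fst hA0; simp only at this; omega
    · exact absurd hsZ hzE'
  -- `P₀` is singly visited
  have hPsv : ∀ l < n, ω.2.fc l = ω.2.fc i' → l = i' := by
    intro l hl hfl
    by_contra hne
    have hall : ∀ s, ω.2.UsesSide (x₀, w.2) s := fun s => by
      rw [← hfcP]; exact ω.2.usesSide_of_fc_eq hi'n hl (Ne.symm hne) hfl.symm s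
    obtain ⟨g₁, hPg₁, hg₁2, hg₁1⟩ := hWend x₀ hcolP (hall .W)
    obtain ⟨g₂, hPg₂, hg₂2, hg₂1, hg₂w⟩ := hEend x₀ hcolP (hall .E)
    obtain ⟨a1, a2, a3, a4, a5⟩ := hout_row g₁ hg₁2 (by omega)
    obtain ⟨c1, c2, c3, c4, c5⟩ := hout_row g₂ hg₂2 (by omega)
    exact houts g₁ g₂ hPg₁ hPg₂ (fun e => by have := congrArg Prod.fst e; omega) a1 a2 a3 a4 a5 c1 c2 c3 c4 c5
  -- its arc is straight (a turn would make `P₀` an isolated turn whose horizontal chain ends at a second outsider)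
  have hPst : arcKind (ω.2.sIn i') (ω.2.sOut i') = .straight := by
    by_contra hk
    have hPP : P (x₀, w.2) := by rw [← hfcP]; exact hPiso i' hi'n hPsv hk
    obtain ⟨p1, p2, p3, p4, p5⟩ := hout_row (x₀, w.2) rfl (by simp only; omega)
    have hne' := ω.2.sIn_ne_sOut hi'n
    have hEW : (ω.2.sIn i' = .W ∨ ω.2.sOut i' = .W) ∨ (ω.2.sIn i' = .E ∨ ω.2.sOut i' = .E) := by
      revert hSP hk hne'; cases ω.2.sIn i' <;> cases ω.2.sOut i' <;> decide
    rcases hEW with hW | hEx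
    · obtain ⟨g₁, hPg₁, hg₁2, hg₁1⟩ := hWend x₀ hcolP ⟨i', hi'n, hfcP, hW⟩
      obtain ⟨a1, a2, a3, a4, a5⟩ := hout_row g₁ hg₁2 (by omega)
      exact houts _ _ hPP hPg₁ (fun e => by have := congrArg Prod.fst e; simp only at this; omega) p1 p2 p3 p4 p5 a1 a2 a3 a4 a5
    · obtain ⟨g₂, hPg₂, hg₂2, hg₂1, hg₂w⟩ := hEend x₀ hcolP ⟨i', hi'n, hfcP, hEx⟩
      obtain ⟨c1, c2, c3, c4, c5⟩ := hout_row g₂ hg₂2 (by omega)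
      exact houts _ _ hPP hPg₂ (fun e => by have := congrArg Prod.fst e; simp only at this; omega) p1 p2 p3 p4 p5 c1 c2 c3 c4 c5
  have hPN : ω.2.UsesSide (x₀, w.2) .N := by
    have hout := ω.2.sOut_of_straight hi'n hPst
    have key : ω.2.sIn i' = .N ∨ ω.2.sOut i' = .N := by
      revert hSP hout; cases ω.2.sIn i' <;> cases ω.2.sOut i' <;> decide
    exact ⟨i', hi'n, hfcP, key⟩
  have hPS : ω.2.UsesSide (x₀, w.2) .S := ⟨i', hi'n, hfcP, hSP⟩
  ---------------------------------------------------------------- the column above `P₀` climbs to `t`: `x₀ = r.1 − M`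
  obtain ⟨Mc, hSc, hNc, hendc⟩ := ω.2.chain_N htop hPN
  obtain ⟨hMc1, hnotN⟩ : 1 ≤ Mc ∧ ¬ω.2.UsesSide (x₀, w.2 + Mc) .N := by
    rcases hendc with hT | ⟨-, hs0⟩ | ⟨-, hsZ⟩
    · exact hT
    · exact absurd hs0 h0N
    · exact absurd hsZ hzN'
  obtain ⟨iξ, hiξ, hfcξ, hsvξ, hSξ, hninξ, hnoutξ, hkξ⟩ := ω.2.isolated_of_usesSide_not_opp (hSc Mc hMc1 le_rfl) hnotN
  have hPξ : P (x₀, w.2 + Mc) := by rw [← hfcξ]; exact hPiso iξ hiξ hsvξ hkξ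
  have hξtop : w.2 + (Mc : ℤ) ≤ r.2 := by have := htop iξ hiξ; rw [hfcξ] at this; exact this
  -- the horizontal side of the turn `ξ`
  have hneξ := ω.2.sIn_ne_sOut hiξ
  have hξEW : (ω.2.sIn iξ = .W ∨ ω.2.sOut iξ = .W) ∨ (ω.2.sIn iξ = .E ∨ ω.2.sOut iξ = .E) := by
    revert hSξ hninξ hnoutξ hneξ hkξ; cases ω.2.sIn iξ <;> cases ω.2.sOut iξ <;> decide
  have hx₀M : x₀ = r.1 - M ∧ w.2 + (Mc : ℤ) = r.2 := by
    rcases lt_or_eq_of_le hξtop with hlt | heq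
    · -- `ξ` on a middle row: its horizontal chain ends at a second outsider
      exfalso
      obtain ⟨p1, p2, p3, p4, p5⟩ := hout_mid (x₀, w.2 + Mc) (by simp only; omega) hlt
      rcases hξEW with hW | hEx
      · obtain ⟨M₁, hE₁, -, hend₁⟩ := ω.2.chain_W hX ⟨iξ, hiξ, hfcξ, hW⟩
        rcases hend₁ with ⟨hM1', hnot⟩ | ⟨hA0, -⟩ | ⟨hZ, -⟩
        · obtain ⟨i₁, hi₁, hfc₁, hsv₁, -, -, -, hk₁'⟩ := ω.2.isolated_of_usesSide_not_opp (hE₁ M₁ hM1' le_rfl) hnot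
          have hP₁ : P (x₀ - M₁, w.2 + Mc) := by rw [← hfc₁]; exact hPiso i₁ hi₁ hsv₁ hk₁'
          obtain ⟨c1, c2, c3, c4, c5⟩ := hout_mid (x₀ - M₁, w.2 + Mc) (by simp only; omega) (by simp only; omega)
          exact houts _ _ hPξ hP₁ (fun e => by have := congrArg Prod.fst e; simp only at this; omega) p1 p2 p3 p4 p5 c1 c2 c3 c4 c5
        · rw [h0w] at hA0; have := congrArg Prod.snd hA0; simp only at this; omega
        · rw [hfcZ] at hZ; have := congrArg Prod.snd hZ; simp only at this; omega
      · obtain ⟨M₂, hW₂, -, hend₂⟩ := ω.2.chain_E hX' ⟨iξ, hiξ, hfcξ, hEx⟩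
        rcases hend₂ with ⟨hM1', hnot⟩ | ⟨hA0, -⟩ | ⟨-, hsZ⟩
        · obtain ⟨i₁, hi₁, hfc₁, hsv₁, -, -, -, hk₁'⟩ := ω.2.isolated_of_usesSide_not_opp (hW₂ M₂ hM1' le_rfl) hnot
          have hP₁ : P (x₀ + M₂, w.2 + Mc) := by rw [← hfc₁]; exact hPiso i₁ hi₁ hsv₁ hk₁'
          obtain ⟨c1, c2, c3, c4, c5⟩ := hout_mid (x₀ + M₂, w.2 + Mc) (by simp only; omega) (by simp only; omega)
          exact houts _ _ hPξ hP₁ (fun e => by have := congrArg Prod.fst e; simp only at this; omega) p1 p2 p3 p4 p5 c1 c2 c3 c4 c5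
        · rw [h0w] at hA0; have := congrArg Prod.snd hA0; simp only at this; omega
        · exact absurd hsZ hzE'
    · -- `ξ` on the top row: it is `t` (else it would sit among the straight cells between `t` and `r`, or west of `t` with no chain end)
      refine ⟨?_, heq⟩
      by_contra hxne
      rw [heq] at hfcξ hPξ hnotN
      have hξ_not_between : ¬(r.1 - M < x₀) := by
        intro hlt'
        -- then `ξ` is one of the straight cells `(r.1 − m, r.2)`, `1 ≤ m ≤ M − 1`
        have hm : 1 ≤ (r.1 - x₀).toNat ∧ (r.1 - x₀).toNat ≤ M - 1 := ⟨by omega, by omega⟩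
        have e : ((r.1 : ℤ) - ((r.1 - x₀).toNat : ℕ), r.2) = (x₀, r.2) := Prod.ext (by simp only; omega) rfl
        have hst := hcellsW _ hm.1 hm.2 iξ hiξ (by rw [hfcF, e, hfcξ])
        exact hkξ hst
      have hx₀lt : x₀ < r.1 - M := by omega
      rcases hξEW with hW | hEx
      · -- west chain from `ξ`: no end available
        obtain ⟨M₁, hE₁, -, hend₁⟩ := ω.2.chain_W hX ⟨iξ, hiξ, hfcξ, hW⟩
        rcases hend₁ with ⟨hM1', hnot⟩ | ⟨hA0, -⟩ | ⟨hZ, -⟩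
        · obtain ⟨i₁, hi₁, hfc₁, hsv₁, -, -, -, hk₁'⟩ := ω.2.isolated_of_usesSide_not_opp (hE₁ M₁ hM1' le_rfl) hnot
          have hP₁ : P (x₀ - M₁, r.2) := by rw [← hfc₁]; exact hPiso i₁ hi₁ hsv₁ hk₁'
          -- two top-row outsiders `ξ` and this end
          have p1 : ((x₀ : ℤ), r.2) ≠ ((r.1 : ℤ) - M, r.2) := fun e => by have := congrArg Prod.fst e; simp only at this; omega
          have c1 : ((x₀ : ℤ) - M₁, r.2) ≠ ((r.1 : ℤ) - M, r.2) := fun e => by have := congrArg Prod.fst e; simp only at this; omega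
          exact houts _ _ hPξ hP₁ (fun e => by have := congrArg Prod.fst e; simp only at this; omega)
            p1 (fun e => by have := congrArg Prod.fst e; simp only at this; omega)
            (hne_of_row _ _ (by rw [hrow₀']; simp only; omega)) (hne_of_row _ _ (by rw [hrow₁']; simp only; omega))
            (hne_of_row _ _ (by simp only; omega))
            c1 (fun e => by have := congrArg Prod.fst e; simp only at this; omega)
            (hne_of_row _ _ (by rw [hrow₀']; simp only; omega)) (hne_of_row _ _ (by rw [hrow₁']; simp only; omega))
            (hne_of_row _ _ (by simp only; omega))
        · rw [h0w] at hA0; have := congrArg Prod.snd hA0; simp only at this; omega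
        · rw [hfcZ] at hZ; have := congrArg Prod.fst hZ; simp only at this; omega
      · -- east chain from `ξ`: it would have to pass through `t`, which does not use `W`
        obtain ⟨M₂, hW₂, hE₂, hend₂⟩ := ω.2.chain_E hX' ⟨iξ, hiξ, hfcξ, hEx⟩
        have hM₂lt : x₀ + M₂ < r.1 - M := by
          by_contra hge
          have := hW₂ (r.1 - M - x₀).toNat (by omega) (by omega)
          have e : ((x₀ : ℤ) + ((r.1 - M - x₀).toNat : ℕ), r.2) = ((r.1 : ℤ) - M, r.2) := Prod.ext (by simp only; omega) rfl
          rw [e] at this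
          exact hnotW this
        rcases hend₂ with ⟨hM1', hnot⟩ | ⟨hA0, -⟩ | ⟨-, hsZ⟩
        · obtain ⟨i₁, hi₁, hfc₁, hsv₁, -, -, -, hk₁'⟩ := ω.2.isolated_of_usesSide_not_opp (hW₂ M₂ hM1' le_rfl) hnot
          have hP₁ : P (x₀ + M₂, r.2) := by rw [← hfc₁]; exact hPiso i₁ hi₁ hsv₁ hk₁'
          have p1 : ((x₀ : ℤ), r.2) ≠ ((r.1 : ℤ) - M, r.2) := fun e => by have := congrArg Prod.fst e; simp only at this; omega
          have c1 : ((x₀ : ℤ) + M₂, r.2) ≠ ((r.1 : ℤ) - M, r.2) := fun e => by have := congrArg Prod.fst e; simp only at this; omega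
          exact houts _ _ hPξ hP₁ (fun e => by have := congrArg Prod.fst e; simp only at this; omega)
            p1 (fun e => by have := congrArg Prod.fst e; simp only at this; omega)
            (hne_of_row _ _ (by rw [hrow₀']; simp only; omega)) (hne_of_row _ _ (by rw [hrow₁']; simp only; omega))
            (hne_of_row _ _ (by simp only; omega))
            c1 (fun e => by have := congrArg Prod.fst e; simp only at this; omega)
            (hne_of_row _ _ (by rw [hrow₀']; simp only; omega)) (hne_of_row _ _ (by rw [hrow₁']; simp only; omega))
            (hne_of_row _ _ (by simp only; omega))
        · rw [h0w] at hA0; have := congrArg Prod.snd hA0; simp only at this; omega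
        · exact absurd hsZ hzE'
  obtain ⟨hx₀t, hMcY⟩ := hx₀M
  ---------------------------------------------------------------- the column `x₀` between the root row and the top row is straight
  have hcol_straight : ∀ m : ℕ, 1 ≤ m → (m : ℤ) ≤ r.2 - w.2 → ∀ i < n, ω.2.fc i = ((ω.2.fc iT).1, (ω.2.fc iT).2 - m) →
      arcKind (ω.2.sIn i) (ω.2.sOut i) = .straight := by
    intro m hm1 hm2 i hi hfi
    rw [hfcT] at hfi; simp only at hfi
    -- the cell `(x₀, r.2 − m) = (x₀, w.2 + (Mc − m))` uses `N` and `S`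
    have hNm : ω.2.UsesSide (r.1 - M, r.2 - m) .N := by
      have := hNc (Mc - m) (by omega); rw [hx₀t] at this
      have e : w.2 + ((Mc - m : ℕ) : ℤ) = r.2 - m := by omega
      rwa [e] at this
    have hSm : ω.2.UsesSide (r.1 - M, r.2 - m) .S := by
      rcases Nat.lt_or_ge (Mc - m) 1 with h0 | h1
      · have e : (r.2 : ℤ) - m = w.2 := by omega
        rw [e, ← hx₀t]; exact hPS
      · have := hSc (Mc - m) h1 (by omega); rw [hx₀t] at this
        have e : w.2 + ((Mc - m : ℕ) : ℤ) = r.2 - m := by omega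
        rwa [e] at this
    -- and not `W`: a `W`-use would make it a doubly visited plaquette whose two horizontal chains end at two outsiders
    have hWm : ¬ω.2.UsesSide (r.1 - M, r.2 - m) .W := by
      intro hW
      rcases lt_or_eq_of_le (show w.2 ≤ r.2 - (m : ℤ) by omega) with hmid | hroot
      · -- middle row
        have hE' : ω.2.UsesSide (r.1 - M, r.2 - m) .E := by
          by_contra hnE
          obtain ⟨a, ha, hfa, hsa⟩ := hNm
          obtain ⟨b, hb, hfb, hsb⟩ := hSm
          obtain ⟨c, hc', hfc', hsc⟩ := hW
          have eab := ω.2.single_visit_of_not_usesSide hnE ha hb hfa hfb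
          have eac := ω.2.single_visit_of_not_usesSide hnE ha hc' hfa hfc'
          subst eab; subst eac
          have hne'' := ω.2.sIn_ne_sOut ha
          revert hsa hsb hsc hne''; cases ω.2.sIn a <;> cases ω.2.sOut a <;> decide
        obtain ⟨M₁, hE₁, -, hend₁⟩ := ω.2.chain_W hX hW
        obtain ⟨M₂, hW₂, -, hend₂⟩ := ω.2.chain_E hX' hE'
        obtain ⟨g₁, hPg₁, hg₁⟩ : ∃ g₁ : Face, P g₁ ∧ g₁ = ((r.1 : ℤ) - M - M₁, r.2 - m) ∧ 1 ≤ M₁ := by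
          rcases hend₁ with ⟨hM1', hnot⟩ | ⟨hA0, -⟩ | ⟨hZ, -⟩
          · obtain ⟨i₁, hi₁, hfc₁, hsv₁, -, -, -, hk₁'⟩ := ω.2.isolated_of_usesSide_not_opp (hE₁ M₁ hM1' le_rfl) hnot
            exact ⟨_, by rw [← hfc₁]; exact hPiso i₁ hi₁ hsv₁ hk₁', rfl, hM1'⟩
          · rw [h0w] at hA0; have := congrArg Prod.snd hA0; simp only at this; omega
          · rw [hfcZ] at hZ; have := congrArg Prod.snd hZ; simp only at this; omega
        obtain ⟨g₂, hPg₂, hg₂⟩ : ∃ g₂ : Face, P g₂ ∧ g₂ = ((r.1 : ℤ) - M + M₂, r.2 - m) ∧ 1 ≤ M₂ := by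
          rcases hend₂ with ⟨hM1', hnot⟩ | ⟨hA0, -⟩ | ⟨-, hsZ⟩
          · obtain ⟨i₁, hi₁, hfc₁, hsv₁, -, -, -, hk₁'⟩ := ω.2.isolated_of_usesSide_not_opp (hW₂ M₂ hM1' le_rfl) hnot
            exact ⟨_, by rw [← hfc₁]; exact hPiso i₁ hi₁ hsv₁ hk₁', rfl, hM1'⟩
          · rw [h0w] at hA0; have := congrArg Prod.snd hA0; simp only at this; omega
          · exact absurd hsZ hzE'
        obtain ⟨rfl, hM₁1⟩ := hg₁
        obtain ⟨rfl, hM₂1⟩ := hg₂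
        obtain ⟨a1, a2, a3, a4, a5⟩ := hout_mid (((r.1 : ℤ) - M - M₁, r.2 - m)) (by simp only; omega) (by simp only; omega)
        obtain ⟨c1, c2, c3, c4, c5⟩ := hout_mid (((r.1 : ℤ) - M + M₂, r.2 - m)) (by simp only; omega) (by simp only; omega)
        exact houts _ _ hPg₁ hPg₂ (fun e => by have := congrArg Prod.fst e; simp only at this; omega) a1 a2 a3 a4 a5 c1 c2 c3 c4 c5
      · -- the root-row cell `P₀` itself: singly visited, straight, so no `W`
        obtain ⟨c, hc', hfc', hsc⟩ := hW
        have hfc'' : ω.2.fc c = ω.2.fc i' := by rw [hfc', hfcP, hx₀t, hroot]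
        have ec := hPsv c hc' hfc''
        subst ec
        have hout := ω.2.sOut_of_straight hc' hPst
        revert hSP hsc hout; cases ω.2.sIn c <;> cases ω.2.sOut c <;> decide
    exact ω.2.straight_of_usesSide_NS hNm hSm hWm i hi hfi
  ---------------------------------------------------------------- reading the column backwards from `t` dates the parity arc before the first hit
  have hMcT : (r.2 - w.2).toNat ≤ iT := by
    by_contra hlt
    push Not at hlt
    obtain ⟨hfc0, -⟩ := ω.2.run_back_below_of_straight hiT le_rfl hinT
      (fun m hm1 hmM i hi hfi => hcol_straight m hm1 (by omega) i hi hfi) iT le_rfl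
    rw [Nat.sub_self, h0w, hfcT] at hfc0
    have := congrArg Prod.fst hfc0; simp only at this; omega
  obtain ⟨hfcB, -⟩ := ω.2.run_back_below_of_straight hiT hMcT hinT
    (fun m hm1 hmM i hi hfi => hcol_straight m hm1 (by omega) i hi hfi) (r.2 - w.2).toNat le_rfl
  rw [hfcT] at hfcB
  have hfcB' : ω.2.fc (iT - (r.2 - w.2).toNat) = ω.2.fc i' := by
    rw [hfcB, hfcP, hx₀t]; exact Prod.ext rfl (by simp only; omega)
  have := hPsv _ (by omega) hfcB'
  omega

end ΩG

end Literature.Probability.RandomPlanarGeometry.SAW.YangBaxter
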